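import Literature.MathematicalPhysics.QuantumFieldTheory.Balaban1983to89.T4SmallFieldFloorMoment

/-!
# T4SmallFieldFloorBlockCount — the COUNT itself: box plaquettes `6·n⁴`, the printed side `R ≤ L·(log g⁻²)^r`,
the transfer chain through the (1.3) pull-back, and power counting by «A₀ sufficiently large»
[folklore bookkeeping, v1]

Cell `pub-balaban`, T⁴ sub-cell, lineage `t4-ne7c-p2` (spine estimate NE7c, node U5b/U5.E, COUNT × SUPPRESSION member
under the admitted-priced design (η)), generation 9.  KERNEL BOOKKEEPING ONLY: every analytic input is a HYPOTHESIS
SHAPE (a binder), nothing of Bałaban's is asserted, no estimate is proved about his densities.  Imports the lineage's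
gen-8 leaf `T4SmallFieldFloorMoment` (and through it `T4SmallFieldFloorCount`, `T4SiblingInsertion`) and Mathlib ONLY;
consumes BY NAME `T4SiblingInsertion.UniformSmallFieldFloor`, `T4SmallFieldFloorCount.lfEvent`,
`T4SmallFieldFloorMoment.RegularityTransfer`, `….MeanRatio`, `….SecondMomentRatio`, `….secondMomentRatio_of_sq_le`,
`….defect_le_blockCount`, `….chebyshevRatio_eq`, `….thresholdSq_eq`, `….uniformSmallFieldFloor_of_budget_secondMoment`;
touches no §-body of any existing file.

## WHAT GEN 8 LEFT (by name) and WHAT THIS FILE ADDS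

`T4SmallFieldFloorMoment.uniformSmallFieldFloor_half_of_polyCounting` gives the floor (Y) `UniformSmallFieldFloor ν p g
(1/2)` from four kinds of binders: the COUNT `|P_j| ≤ B·x_j^s` of the slot's BLOCK plaquettes, the ordering `s < q`,
the size `x_j ≥ max 1 (2BC)`, and the RATIO `m₂,j/a_j² ≤ C/x_j^q` (itself = the second-moment residual (Y₂) in
mean-action form, `chebyshevRatio_eq`).  The first three are STRUCTURAL — they follow from printed DEFINITIONS, not from
estimates — and this file discharges them in the kernel, inside the seat's technique «count the carrying terms PER SCALE»:

**(1) THE BOX COUNT (§1).**  The variables of the slot are the plaquettes of the level field `V` in a box.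
[Balaban1988Convergent] (the cell's B14) = T. Bałaban, *Convergent renormalization expansions for lattice gauge
theories*, Commun. Math. Phys. 119 (1988) 243–285, p. 246 (render `1988-cmp119-convergent-renormalization-p004` read as
image by this seat; PDF page = journal page − 242): «U_{1,□′}(V) = U(B₁(□′^{~4}), M˙(Q₁^{s*}V)), (1.2) where B₁(□′^{~4})
is the minimal determining set based on □′^{~4}», «The function in (1.2) depends on the field V restricted to □′^{~4}.»,
and p. 257 (render `…-p015` read as image): «U_{k,□}(V_k) = U(B_k(□~⁴), M˙(Q_k^{s*}V_k)), (2.16) where Q_k^{s*}V_k is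
defined as in (1.3), only 1-blocks are replaced by k-blocks.»  A `d`-dimensional box of side `n` (sites `Fin d → Fin n`)
carries `n^d·(d choose 2)` (base point, plane) pairs, `6·n⁴` for `d = 4` (`card_boxPlaquette`, `card_boxPlaquette_four`),
and ANY finite family injected into them has at most that many members (`card_le_of_injOn_box(_four)`).  The injection
`Pc(σ) ↪ BoxPlaquette 4 n` — which plaquettes of `V_j` the slot reads, and in which box they sit — is the INSTANTIATING
seat's (from (2.16) and the sentence above); it is a binder here.

**(2) THE PRINTED SIDE (§2).**  p. 246 (same render): «We introduce the next two partitions of the lattice T₁. The first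
is into cubes of the size LMR₁, where R₁ is the smallest power of L such, that R₁ ≥ (log g₁⁻²)^r. The second is into
cubes of the size L²M₂R₁. For the more natural scale L⁻¹ these are partitions of the lattice T_{L⁻¹} into MR₁-cubes and
LM₂R₁-cubes correspondingly.» and «(the operation ~ is determined by the LMR₁-cubes)».  `smallestPowGe hL y` IS that
definition (`Nat.find`), with `y ≤ R` (`le_smallestPowGe`) and — the only property the count needs — `R ≤ L·y` for
`y ≥ 1` (`smallestPowGe_le_mul`: the previous power of `L` is below `y`).  So a box of side `n ≤ w·R_j` (in the natural
scale, where `V_j` lives on the unit lattice, `□` is an `LM₂R_j`-cube and `~` adds `MR_j` per side, `□^{~4}` has side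
`(LM₂ + 8M)·R_j`; the width `w` in `R_j`-units is NOT fixed here — it absorbs the reading of `~`, of «restricted to», and
boundary `+1`'s, and is pinned by the instantiating seat) has `n ≤ (wL)·x_j^r`, `x_j = log g_j⁻²`, and the count is
`≤ 6(wL)⁴·x_j^{4r} = B′·x_j^s` with `B′ = 6N⁴`, `N = wL`, `s = 4r` EXPLICIT (`count_le_poly`, `side_le_of_smallestPow`).

**(3) THE TRANSFER CHAIN (§3).**  Gen 8's `RegularityTransfer Pf Pc X Y a b` («all block variables below b ⇒ all read
variables below a») is instantiated in print by TWO steps, and typing them separately lets each be QUOTED separately: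
(i) the (1.3) PULL-BACK, p. 246: «(Q₁^{s*}V)(b) = 1 for b ⊂ B(y), y ∈ T^{(1)}; V(c) for b ∈ B(c) = {b : b₋ ∈ B(c₋),
b₊ ∈ B(c₊)}, c ∈ T^{(1)} (1.3)» — every plaquette variable of the DATA configuration `M˙(Q_j^{s*}V_j)` on the
determining set is `1` or a plaquette variable of `V_j` in the box, i.e. in deviation variables every datum `Z_d` is `0`
or dominated by SOME `|Y_k|` with constant ONE (`regularityTransfer_of_valuesIn`: transfer `Pd ← Pc` at the SAME
threshold; that the block averages of the section add no new values is ONE unprinted line, NOT asserted here);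
(ii) [Balaban1985Variational] (the cell's B11) = T. Bałaban, *The variational problem and background fields in
renormalization group method for lattice gauge theories*, Commun. Math. Phys. 102 (1985) 277–309, p. 278 (7) «|(∂V)(p′) −
1| < ε₁ for p′ ∈ 𝔅_k» and p. 279 Theorem 1 (quoted in full in `T4SmallFieldFloorMoment`; renders
`1985-cmp102-variational-background-p002/p003`): data below `ε₁ ≤ a₁` ⇒ the minimiser's read plaquettes below `B₃ε₁`
after scale normalisation — transfer `Pf ← Pd` at thresholds `(a, a/B₃)`.  Composition (`regularityTransfer_trans`) is
the transfer `Pf ← Pc` at `(a, a/B₃)` that gen 8's floor theorems consume.  NEITHER step is asserted for ℝ's localized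
determining sets `B_j(□^{~4})`; both are binders (`h13`, `hthm1`) of the end-to-end theorem.

**(4) POWER COUNTING BY PRINT'S OWN DEVICE (§4).**  p. 246: «in the first step we take ε₀ = g₀p₀(g₀), p₀(g₀) =
A₀(log g₀⁻²)^{p₀}, p₀ ≥ 5r and A₀ is a sufficiently large constant».  With `s ≤ q` (here `4r ≤ 2p₀`, implied by
`2r ≤ p₀`, a fortiori by «p₀ ≥ 5r») and `x ≥ 1` ONLY: `B′x^s·(C/x^q) ≤ B′C` (`polyCount_mul_ratio_le`), so the floor is
`≥ 1/2` as soon as `2B′C ≤ 1` (`floor_ge_half_of_largeConstant`); and since the Chebyshev constant is `C = D/A₀²` with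
`D = κE₀B₃²/(1−ρ₀)²` (`chebyshevRatio_eq`, `thresholdSq_eq`), that is the LARGENESS `2B′D ≤ A₀²` of the free constant
`A₀` (`largeConstant_iff`) — NO smallness of the coupling beyond `log g_j⁻² ≥ 1` is used.  (Gen 8's `x_j ≥ max 1 (2B′C)`
was, on the young band `j ≥ K − N`, a condition on the near-physical coupling; it is not needed.  Whether `E₀` is
`A₀`-independent is part of the `E₀` binder, which is NOT PRINTED either way.)

**(5) END TO END (§5).**  `uniformSmallFieldFloor_half_of_largeConstant` (abstract: count `≤ Bx^s`, ratio `≤ C/x^q`,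
`s ≤ q`, `x_j ≥ 1`, `2BC ≤ 1`) and the PHYSICAL PARAMETRISATION `uniformSmallFieldFloor_half_of_blockCount_meanAction`:
per fibre `j` the read family `Pf j`, the data family `Pd j`, the `V`-plaquette family `Pc j` with `|Pc j| ≤ 6·(n j)⁴`,
`n j ≤ N·x_j^r`; deviation variables `X, Z, Y` and action densities `A` with `Y² ≤ κ·A` pointwise (Hilbert–Schmidt,
gen 8 §3); the residual (Y₂) in MEAN-ACTION form `MeanRatio (ν j) (A j k) (g j) (cpl_j²·E₀)` — NOT PRINTED, the one
analytic input, owner = the instantiating lineage; the plateau of the profile at the lowered threshold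
`a_j = (1−ρ₀)·cpl_j·A₀x_j^{p₀}` (`loweredThreshold`); the two transfer shapes at `(a_j, a_j/B₃)`; `2r ≤ p₀`; `x_j ≥ 1`;
`2·(6N⁴)·κE₀B₃²/(1−ρ₀)² ≤ A₀²`.  Conclusion `UniformSmallFieldFloor ν p g (1/2)` LITERALLY (gen 7/8 by name), `rσ = 2`
for the socket (`T4LipschitzLedgerSocket`, cited by name only).  Variants: the box given by an injection
(`…_of_boxEmbedding`) and the side given by the printed `R_j` (`…_of_printedSide`, `N = wL`).

## HONEST LIMITS / THIS IS NOT
* NOT PRINTED and NOT proved here: (Y₂)/`MeanRatio`/`E₀` and its uniformity over fibres, exterior pinning, position of the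
  slot and `A₀`; the (1.3) pull-back for the block averages on the layers of `B_j(□^{~4})`; the applicability of
  [Balaban1985Variational] Theorem 1 (with `ε₁ ≤ a₁`) to ℝ's localized determining sets; the box embedding and its width
  `w`.  Each is a binder of the theorem that uses it.  PROVED here: finite combinatorics, the `Nat.find` arithmetic of
  «smallest power of L», composition of transfer shapes, and real-number power counting — nothing else.
* Rung (B)+1, finite `T⁴` only: NOT infinite volume, NOT a mass gap, NOT the Clay problem, NOT summit progress.
  BetaPertH/(B)/(B^μ)/U5a stay explicit and conditional upstream.  ABSOLUTE RULE: the manuscripts are quoted for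
  DEFINITIONS, MECHANISM and LOCI only (pages and renders named above, read as images by this seat); no internally-minted
  statement is cited as a fact; Theorem 1 and (1.3) are USED ONLY AS HYPOTHESIS SHAPES.
-/

open MeasureTheory Finset

namespace Literature.MathematicalPhysics.QuantumFieldTheory.Balaban1983to89.T4SmallFieldFloorBlockCount

open T4SiblingInsertion T4SmallFieldFloorCount T4SmallFieldFloorMoment

/-! ## §1 THE BOX COUNT: `n^d · (d choose 2)` plaquettes, `6·n⁴` in `d = 4` -/

section BoxCount

/-- The coordinate PLANES of a `d`-dimensional lattice: 2-element subsets of the `d` directions. [folklore] -/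
abbrev Plane (d : ℕ) : Type := {s : Finset (Fin d) // s ∈ (Finset.univ : Finset (Fin d)).powersetCard 2}

/-- The PLAQUETTES OF A BOX of side `n` in `d` dimensions, indexed by (base point, plane): the index set into which the
instantiating seat injects the slot's `V`-plaquettes ([Balaban1988Convergent] p. 246 «The function in (1.2) depends on
the field V restricted to □′^{~4}.»). [folklore] -/
abbrev BoxPlaquette (d n : ℕ) : Type := (Fin d → Fin n) × Plane d

/-- There are `d choose 2` planes. [folklore] -/
theorem card_plane (d : ℕ) : Fintype.card (Plane d) = d.choose 2 := by
  rw [Fintype.card_coe, Finset.card_powersetCard, Finset.card_univ, Fintype.card_fin]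

/-- **THE BOX COUNT**: `|BoxPlaquette d n| = n^d · (d choose 2)`. [folklore] -/
theorem card_boxPlaquette (d n : ℕ) : Fintype.card (BoxPlaquette d n) = n ^ d * d.choose 2 := by
  rw [Fintype.card_prod, Fintype.card_fun, Fintype.card_fin, Fintype.card_fin, card_plane]

/-- `4 choose 2 = 6`. [folklore] -/
theorem choose_four_two : Nat.choose 4 2 = 6 := by decide

/-- **`d = 4`: a box of side `n` has `6·n⁴` plaquettes.** [folklore] -/
theorem card_boxPlaquette_four (n : ℕ) : Fintype.card (BoxPlaquette 4 n) = 6 * n ^ 4 := by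
  rw [card_boxPlaquette, choose_four_two, mul_comm]

/-- **COUNT BY INJECTION INTO A BOX.**  A finite family injected into the plaquettes of a box of side `n` has at most
`n^d·(d choose 2)` members. [folklore] -/
theorem card_le_of_injOn_box {κ : Type*} (P : Finset κ) {d n : ℕ} (φ : κ → BoxPlaquette d n)
    (hφ : Set.InjOn φ P) : P.card ≤ n ^ d * d.choose 2 := by
  calc P.card ≤ (Finset.univ : Finset (BoxPlaquette d n)).card :=
        Finset.card_le_card_of_injOn φ (fun _ _ => Finset.mem_coe.2 (Finset.mem_univ _)) hφ
    _ = n ^ d * d.choose 2 := by rw [Finset.card_univ, card_boxPlaquette]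

/-- `d = 4`: at most `6·n⁴` members. [folklore] -/
theorem card_le_of_injOn_box_four {κ : Type*} (P : Finset κ) {n : ℕ} (φ : κ → BoxPlaquette 4 n)
    (hφ : Set.InjOn φ P) : P.card ≤ 6 * n ^ 4 := by
  have h := card_le_of_injOn_box P φ hφ
  rwa [choose_four_two, mul_comm] at h

end BoxCount

/-! ## §2 THE PRINTED SIDE: «R₁ is the smallest power of L such, that R₁ ≥ (log g₁⁻²)^r» ⇒ `R ≤ L·(log g⁻²)^r` -/

section PrintedSide

variable {L : ℕ}

/-- Powers of `L ≥ 2` are unbounded. [folklore] -/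
theorem exists_pow_ge (hL : 1 < L) (y : ℝ) : ∃ m : ℕ, y ≤ (L : ℝ) ^ m := by
  obtain ⟨m, hm⟩ := pow_unbounded_of_one_lt y (show (1 : ℝ) < L by exact_mod_cast hL)
  exact ⟨m, hm.le⟩

/-- The exponent of the smallest power of `L` that is `≥ y`. [folklore] -/
noncomputable def smallestPowExp (hL : 1 < L) (y : ℝ) : ℕ := Nat.find (exists_pow_ge hL y)

/-- **«the smallest power of L such, that R ≥ y»** ([Balaban1988Convergent] p. 246, with `y = (log g⁻²)^r`): the
printed DEFINITION of the radius `R`, as a natural number. [folklore] -/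
noncomputable def smallestPowGe (hL : 1 < L) (y : ℝ) : ℕ := L ^ smallestPowExp hL y

/-- `R ≥ y`. [folklore] -/
theorem le_smallestPowGe (hL : 1 < L) (y : ℝ) : y ≤ (smallestPowGe hL y : ℝ) := by
  unfold smallestPowGe smallestPowExp
  push_cast
  exact Nat.find_spec (exists_pow_ge hL y)

/-- `R` is a power of `L`. [folklore] -/
theorem smallestPowGe_eq_pow (hL : 1 < L) (y : ℝ) : ∃ m : ℕ, smallestPowGe hL y = L ^ m := ⟨_, rfl⟩

/-- Minimality: any power of `L` that is `≥ y` is `≥ R`. [folklore] -/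
theorem smallestPowGe_le_pow (hL : 1 < L) {y : ℝ} {m : ℕ} (h : y ≤ (L : ℝ) ^ m) : smallestPowGe hL y ≤ L ^ m :=
  Nat.pow_le_pow_right (by omega) (Nat.find_min' (exists_pow_ge hL y) h)

/-- `1 ≤ R`. [folklore] -/
theorem one_le_smallestPowGe (hL : 1 < L) (y : ℝ) : 1 ≤ smallestPowGe hL y := Nat.one_le_pow _ _ (by omega)

/-- **THE ONLY PROPERTY THE COUNT NEEDS: `R ≤ L·y` for `y ≥ 1`** (the previous power of `L` is below `y`). [folklore] -/
theorem smallestPowGe_le_mul (hL : 1 < L) {y : ℝ} (hy : 1 ≤ y) : (smallestPowGe hL y : ℝ) ≤ L * y := by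
  have hL0 : (0 : ℝ) ≤ L := Nat.cast_nonneg _
  have hL1 : (1 : ℝ) ≤ L := by exact_mod_cast hL.le
  unfold smallestPowGe
  rcases Nat.eq_zero_or_eq_succ_pred (smallestPowExp hL y) with h0 | hs
  · rw [h0, pow_zero]
    push_cast
    nlinarith
  · have hlt : smallestPowExp hL y - 1 < smallestPowExp hL y := by omega
    have hmin : ¬ y ≤ (L : ℝ) ^ (smallestPowExp hL y - 1) := Nat.find_min (exists_pow_ge hL y) hlt
    have hlt' : (L : ℝ) ^ (smallestPowExp hL y - 1) < y := lt_of_not_ge hmin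
    rw [hs, pow_succ]
    push_cast
    calc (L : ℝ) ^ (smallestPowExp hL y - 1) * L ≤ y * L := by gcongr
      _ = L * y := mul_comm _ _

/-- **SIDE OF THE BOX FROM THE PRINTED RADIUS.**  If the box side is `n ≤ w·R` (`w ≥ 0` = its width in `R`-units) with
`R = smallestPowGe hL (x^r)` and `x ≥ 1`, then `n ≤ (w·L)·x^r`. [folklore] -/
theorem side_le_of_smallestPow (hL : 1 < L) {n : ℕ} {w x : ℝ} {r : ℕ} (hw : 0 ≤ w) (hx : 1 ≤ x)
    (hn : (n : ℝ) ≤ w * smallestPowGe hL (x ^ r)) : (n : ℝ) ≤ w * L * x ^ r := by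
  have h := smallestPowGe_le_mul hL (one_le_pow₀ hx : (1 : ℝ) ≤ x ^ r)
  calc (n : ℝ) ≤ w * smallestPowGe hL (x ^ r) := hn
    _ ≤ w * (L * x ^ r) := mul_le_mul_of_nonneg_left h hw
    _ = w * L * x ^ r := by ring

/-- **THE COUNT IS POLYNOMIAL IN `x = log g⁻²` WITH EXPLICIT CONSTANT**: `|Pc| ≤ 6n⁴`, `n ≤ N·x^r`
⇒ `|Pc| ≤ 6N⁴·x^{4r}` (no sign condition on `N`, `x` is needed: fourth powers). [folklore] -/
theorem count_le_poly {P₀ n : ℕ} {N x : ℝ} {r : ℕ} (hP : P₀ ≤ 6 * n ^ 4) (hn : (n : ℝ) ≤ N * x ^ r) :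
    (P₀ : ℝ) ≤ 6 * N ^ 4 * x ^ (4 * r) := by
  have hn0 : (0 : ℝ) ≤ n := Nat.cast_nonneg _
  have h1 : (P₀ : ℝ) ≤ 6 * (n : ℝ) ^ 4 := by exact_mod_cast hP
  have h2 : (n : ℝ) ^ 4 ≤ (N * x ^ r) ^ 4 := pow_le_pow_left₀ hn0 hn 4
  calc (P₀ : ℝ) ≤ 6 * (n : ℝ) ^ 4 := h1
    _ ≤ 6 * (N * x ^ r) ^ 4 := by linarith
    _ = 6 * N ^ 4 * x ^ (4 * r) := by rw [mul_pow, ← pow_mul, mul_comm r 4]; ring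

end PrintedSide

/-! ## §3 THE TRANSFER CHAIN: (1.3) pull-back `Pd ← Pc` at the same threshold, then Theorem 1 `Pf ← Pd` -/

section TransferChain

variable {Ω₀ ι δ κ : Type*}

/-- **COMPOSITION OF TRANSFERS.**  `Pd ← Pc` at `(e, b)` and `Pf ← Pd` at `(a, e)` give `Pf ← Pc` at `(a, b)` — the middle
threshold must MATCH (negative control in §6). [folklore] -/
theorem regularityTransfer_trans (Pf : Finset ι) (Pd : Finset δ) (Pc : Finset κ) (X : ι → Ω₀ → ℝ)
    (Z : δ → Ω₀ → ℝ) (Y : κ → Ω₀ → ℝ) {a e b : ℝ} (h₁ : RegularityTransfer Pd Pc Z Y e b)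
    (h₂ : RegularityTransfer Pf Pd X Z a e) : RegularityTransfer Pf Pc X Y a b :=
  fun ω hY => h₂ ω (h₁ ω hY)

/-- Monotonicity in the thresholds: raising the read threshold or lowering the block threshold keeps a transfer.
[folklore] -/
theorem regularityTransfer_mono {Pf : Finset ι} {Pc : Finset κ} {X : ι → Ω₀ → ℝ} {Y : κ → Ω₀ → ℝ}
    {a a' b b' : ℝ} (h : RegularityTransfer Pf Pc X Y a b) (ha : a ≤ a') (hb : b' ≤ b) :
    RegularityTransfer Pf Pc X Y a' b' :=
  fun ω hY i hi => lt_of_lt_of_le (h ω (fun k hk => lt_of_lt_of_le (hY k hk) hb) i hi) ha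

/-- Monotonicity in the families: fewer read variables, more block variables. [folklore] -/
theorem regularityTransfer_subset {Pf Pf' : Finset ι} {Pc Pc' : Finset κ} {X : ι → Ω₀ → ℝ} {Y : κ → Ω₀ → ℝ}
    {a b : ℝ} (h : RegularityTransfer Pf Pc X Y a b) (hf : Pf' ⊆ Pf) (hc : Pc ⊆ Pc') :
    RegularityTransfer Pf' Pc' X Y a b :=
  fun ω hY i hi => h ω (fun k hk => hY k (hc hk)) i (hf hi)

/-- **THE (1.3) PULL-BACK SHAPE** ([Balaban1988Convergent] p. 246 (1.3): the section `Q^{s*}V` is `1` on bonds inside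
blocks and `V(c)` on bonds between blocks, so each of its plaquette variables — and, by one unprinted line, each plaquette
variable of its block averages — is `1` or a plaquette variable of `V`).  In deviation variables: if every datum `Z_d`,
`d ∈ Pd`, is `0` or dominated by SOME `|Y_k|`, `k ∈ Pc` (constant ONE), then `Pd ← Pc` transfers at the SAME threshold
`b > 0`.  The hypothesis `hval` is the instantiating seat's; NOT asserted here. [folklore] -/
theorem regularityTransfer_of_valuesIn (Pd : Finset δ) (Pc : Finset κ) (Z : δ → Ω₀ → ℝ) (Y : κ → Ω₀ → ℝ)
    {b : ℝ} (hb : 0 < b) (hval : ∀ ω, ∀ d ∈ Pd, Z d ω = 0 ∨ ∃ k ∈ Pc, |Z d ω| ≤ |Y k ω|) :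
    RegularityTransfer Pd Pc Z Y b b := by
  intro ω hY d hd
  rcases hval ω d hd with h0 | ⟨k, hk, hle⟩
  · rw [h0, abs_zero]
    exact hb
  · exact lt_of_le_of_lt hle (hY k hk)

/-- **THE CHAIN**: (1.3) pull-back `Pd ← Pc` at `(b, b)` composed with the Theorem-1 shape `Pf ← Pd` at `(a, b)` is the
transfer `Pf ← Pc` at `(a, b)` consumed by gen 8's `defect_le_blockCount` / `smallFieldFloor_of_transfer_secondMoment`.
[folklore] -/
theorem regularityTransfer_of_pullback_thm1 (Pf : Finset ι) (Pd : Finset δ) (Pc : Finset κ) (X : ι → Ω₀ → ℝ)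
    (Z : δ → Ω₀ → ℝ) (Y : κ → Ω₀ → ℝ) {a b : ℝ} (h13 : RegularityTransfer Pd Pc Z Y b b)
    (hthm1 : RegularityTransfer Pf Pd X Z a b) : RegularityTransfer Pf Pc X Y a b :=
  regularityTransfer_trans Pf Pd Pc X Z Y h13 hthm1

end TransferChain

/-! ## §4 POWER COUNTING BY «A₀ IS A SUFFICIENTLY LARGE CONSTANT»: `s ≤ q`, `x ≥ 1`, `2B′C ≤ 1` ⇒ floor `≥ 1/2` -/

section LargeConstant

/-- For `0 ≤ B`, `0 ≤ C`, `s ≤ q`, `x ≥ 1`: `B·x^s·(C/x^q) ≤ B·C`. [folklore] -/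
theorem polyCount_mul_ratio_le {B C x : ℝ} {s q : ℕ} (hB : 0 ≤ B) (hC : 0 ≤ C) (hsq : s ≤ q) (hx : 1 ≤ x) :
    B * x ^ s * (C / x ^ q) ≤ B * C := by
  have hx0 : 0 < x := by linarith
  have hxq : 0 < x ^ q := pow_pos hx0 q
  have hpow : x ^ s ≤ x ^ q := pow_le_pow_right₀ hx hsq
  calc B * x ^ s * (C / x ^ q) = B * C * (x ^ s / x ^ q) := by ring
    _ ≤ B * C * 1 := by
        refine mul_le_mul_of_nonneg_left ?_ (mul_nonneg hB hC)
        rwa [div_le_one hxq]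
    _ = B * C := mul_one _

/-- **⇒ THE FLOOR IS AT LEAST `1/2` FOR EVERY `x ≥ 1` ONCE `2BC ≤ 1`.**  Count `P₀ ≤ B·x^s`, ratio `m₂/a² ≤ C/x^q`,
`s ≤ q`. [folklore] -/
theorem floor_ge_half_of_largeConstant {B C : ℝ} {s q : ℕ} (hB : 0 ≤ B) (hC : 0 ≤ C) (hsq : s ≤ q) {x : ℝ}
    (hx : 1 ≤ x) (hBC : 2 * B * C ≤ 1) {P₀ m₂ a : ℝ} (hcount : P₀ ≤ B * x ^ s) (hratio0 : 0 ≤ m₂ / a ^ 2)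
    (hratio : m₂ / a ^ 2 ≤ C / x ^ q) : 1 / 2 ≤ 1 - P₀ * (m₂ / a ^ 2) := by
  have h := polyCount_mul_ratio_le hB hC hsq hx
  have h1 : P₀ * (m₂ / a ^ 2) ≤ B * x ^ s * (C / x ^ q) :=
    mul_le_mul hcount hratio hratio0 (mul_nonneg hB (pow_nonneg (by linarith) s))
  linarith

/-- **THE LARGENESS OF `A₀`.**  With the Chebyshev constant `C = D/A₀²` (`D = κE₀B₃²/(1−ρ₀)²` from gen 8's
`chebyshevRatio_eq` and `thresholdSq_eq`), `2B·C ≤ 1 ↔ 2B·D ≤ A₀²` for `A₀ > 0` — print's «A₀ is a sufficiently large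
constant» ([Balaban1988Convergent] p. 246), NOT a smallness of the coupling. [folklore] -/
theorem largeConstant_iff {B D A₀ : ℝ} (hA : 0 < A₀) : 2 * B * (D / A₀ ^ 2) ≤ 1 ↔ 2 * B * D ≤ A₀ ^ 2 := by
  rw [show 2 * B * (D / A₀ ^ 2) = 2 * B * D / A₀ ^ 2 by ring, div_le_one (pow_pos hA 2)]

/-- The window arithmetic: `2r ≤ p₀` (a fortiori print's «p₀ ≥ 5r») gives `4r ≤ 2p₀`. [folklore] -/
theorem four_mul_le_two_mul {r p₀ : ℕ} (h : 2 * r ≤ p₀) : 4 * r ≤ 2 * p₀ := by omega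

/-- … and «p₀ ≥ 5r» gives `2r ≤ p₀`. [folklore] -/
theorem two_mul_le_of_five_mul_le {r p₀ : ℕ} (h : 5 * r ≤ p₀) : 2 * r ≤ p₀ := by omega

end LargeConstant

/-! ## §5 END TO END -/

section EndToEnd

variable {ι δ κ J : Type*} {Ω₁ : J → Type*} [∀ j, MeasurableSpace (Ω₁ j)] {ν : (j : J) → Measure (Ω₁ j)}
  {p g : (j : J) → Ω₁ j → ℝ}

/-- **(Y) WITH `c = 1/2`, ABSTRACT FORM, NO SMALLNESS OF `x` BEYOND `x ≥ 1`.**  Per fibre `j` the data of gen 8's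
`uniformSmallFieldFloor_of_budget_secondMoment`, a size `x_j ≥ 1`, count `|P_j| ≤ B·x_j^s`, ratio `m₂,j/a_j² ≤ C/x_j^q`,
`s ≤ q`, and the LARGENESS `2BC ≤ 1`.  Conclusion `UniformSmallFieldFloor ν p g (1/2)`.  CONDITIONAL on its binders;
(Y₂) (`h2`) is NOT PRINTED. [folklore] -/
theorem uniformSmallFieldFloor_half_of_largeConstant (P : J → Finset ι) (X : (j : J) → ι → Ω₁ j → ℝ)
    (a m₂ x : J → ℝ) {B C : ℝ} {s q : ℕ} (hB : 0 ≤ B) (hC : 0 ≤ C) (hsq : s ≤ q) (hBC : 2 * B * C ≤ 1)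
    (hX : ∀ j, ∀ i ∈ P j, Measurable (X j i)) (ha : ∀ j, 0 < a j) (hm : ∀ j, 0 ≤ m₂ j)
    (hg : ∀ j, Integrable (g j) (ν j)) (hpg : ∀ j, Integrable (fun ω => p j ω * g j ω) (ν j))
    (hg0 : ∀ j, 0 ≤ᵐ[ν j] g j)
    (hdom : ∀ j, ∀ᵐ ω ∂ν j, 1 - p j ω ≤ ∑ i ∈ P j, (lfEvent (X j i) (a j)).indicator (fun _ => (1 : ℝ)) ω)
    (h2 : ∀ j, ∀ i ∈ P j, SecondMomentRatio (ν j) (X j i) (g j) (m₂ j))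
    (hx : ∀ j, 1 ≤ x j) (hcount : ∀ j, ((P j).card : ℝ) ≤ B * x j ^ s)
    (hratio : ∀ j, m₂ j / a j ^ 2 ≤ C / x j ^ q) :
    UniformSmallFieldFloor ν p g (1 / 2) := by
  refine uniformSmallFieldFloor_of_budget_secondMoment P X a m₂ hX ha hm hg hpg hg0 hdom h2 (by norm_num) fun j => ?_
  have h := floor_ge_half_of_largeConstant hB hC hsq (hx j) hBC (hcount j)
    (div_nonneg (hm j) (sq_nonneg _)) (hratio j)
  linarith

/-- The lowered small-field threshold of the slot in scale-normalised units: `a = (1−ρ₀)·ε`, `ε = g·p₀(g) = g·A₀x^{p₀}`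
([Balaban1988Convergent] p. 246 «ε₁ = g₁p₀(g₁)», «p₀(g₀) = A₀(log g₀⁻²)^{p₀}»; `ρ₀` = the profile's plateau parameter,
`T4LipschitzCutoff`).  A NAME for an expression, no content. [folklore] -/
noncomputable def loweredThreshold (ρ₀ cpl A₀ x : ℝ) (p₀ : ℕ) : ℝ := (1 - ρ₀) * (cpl * (A₀ * x ^ p₀))

/-- The lowered threshold is positive for `ρ₀ < 1`, `cpl, A₀, x > 0`. [folklore] -/
theorem loweredThreshold_pos {ρ₀ cpl A₀ x : ℝ} {p₀ : ℕ} (hρ : ρ₀ < 1) (hc : 0 < cpl) (hA : 0 < A₀) (hx : 0 < x) :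
    0 < loweredThreshold ρ₀ cpl A₀ x p₀ :=
  mul_pos (by linarith) (mul_pos hc (mul_pos hA (pow_pos hx _)))

/-- **THE CHEBYSHEV RATIO AT THE BLOCK THRESHOLD `a/B₃`** is `(κE₀B₃²/((1−ρ₀)²A₀²))/x^{2p₀}` — gen 8's
`chebyshevRatio_eq` and `thresholdSq_eq` assembled. [folklore] -/
theorem blockRatio_eq {κ₀ E₀ B₃ ρ₀ A₀ cpl x : ℝ} {p₀ : ℕ} (hc : cpl ≠ 0) (hB : B₃ ≠ 0) (hρ : ρ₀ ≠ 1)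
    (hA : A₀ ≠ 0) (hx : x ≠ 0) :
    κ₀ * (cpl ^ 2 * E₀) / (loweredThreshold ρ₀ cpl A₀ x p₀ / B₃) ^ 2 =
      κ₀ * E₀ * B₃ ^ 2 / ((1 - ρ₀) ^ 2 * A₀ ^ 2) / x ^ (2 * p₀) := by
  have hP : A₀ * x ^ p₀ ≠ 0 := mul_ne_zero hA (pow_ne_zero _ hx)
  have h1 : (1 - ρ₀) ≠ 0 := sub_ne_zero.2 (Ne.symm hρ)
  unfold loweredThreshold
  rw [show (1 - ρ₀) * (cpl * (A₀ * x ^ p₀)) / B₃ = (1 - ρ₀) * (cpl * (A₀ * x ^ p₀)) / B₃ from rfl,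
    chebyshevRatio_eq hc hB hρ hP, thresholdSq_eq]
  have hx2 : x ^ (2 * p₀) ≠ 0 := pow_ne_zero _ hx
  field_simp

/-- **END TO END, PHYSICAL PARAMETRISATION: (Y) WITH `c = 1/2` FROM THE BOX COUNT, THE TRANSFER CHAIN, (Y₂) IN
MEAN-ACTION FORM, AND «A₀ SUFFICIENTLY LARGE».**  Per fibre `j`: READ family `Pf j` (finest plaquettes in `□~`), DATA
family `Pd j` (plaquettes of the determining-set data), `V`-PLAQUETTE family `Pc j` with the box count `|Pc j| ≤ 6(n j)⁴`
and side `n j ≤ N·x_j^r`; deviations `X, Z, Y`, action densities `A` with `Y² ≤ κ₀·A`; (Y₂) as `MeanRatio (ν j) (A j k)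
(g j) (cpl_j²·E₀)` — NOT PRINTED; profile `p j ≥ 0` with plateau `= 1` when all read deviations are below
`a_j = loweredThreshold ρ₀ (cpl j) A₀ (x j) p₀`; the (1.3) pull-back `Pd j ← Pc j` at `(a_j/B₃, a_j/B₃)` and the
Theorem-1 shape `Pf j ← Pd j` at `(a_j, a_j/B₃)` — NOT asserted; `2r ≤ p₀`; `x_j ≥ 1`; `cpl j > 0`; and the largeness
`2·(6N⁴)·(κ₀E₀B₃²/(1−ρ₀)²) ≤ A₀²`.  Conclusion: `UniformSmallFieldFloor ν p g (1/2)`.  The relation `x_j = log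
(cpl j)⁻²` is NOT used: only that the count and the threshold carry the SAME `x_j`. [folklore] -/
theorem uniformSmallFieldFloor_half_of_blockCount_meanAction
    (Pf : J → Finset ι) (Pd : J → Finset δ) (Pc : J → Finset κ)
    (X : (j : J) → ι → Ω₁ j → ℝ) (Z : (j : J) → δ → Ω₁ j → ℝ) (Y A : (j : J) → κ → Ω₁ j → ℝ)
    {κ₀ E₀ B₃ ρ₀ A₀ N : ℝ} {r p₀ : ℕ} (n : J → ℕ) (cpl x : J → ℝ)
    (hκ : 0 ≤ κ₀) (hE : 0 ≤ E₀) (hB₃ : 0 < B₃) (hρ : ρ₀ < 1) (hA₀ : 0 < A₀)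
    (hrp : 2 * r ≤ p₀) (hlarge : 2 * (6 * N ^ 4) * (κ₀ * E₀ * B₃ ^ 2 / (1 - ρ₀) ^ 2) ≤ A₀ ^ 2)
    (hcpl : ∀ j, 0 < cpl j) (hx : ∀ j, 1 ≤ x j)
    (hbox : ∀ j, (Pc j).card ≤ 6 * n j ^ 4) (hn : ∀ j, (n j : ℝ) ≤ N * x j ^ r)
    (hY : ∀ j, ∀ k ∈ Pc j, Measurable (Y j k)) (hYA : ∀ j, ∀ k ∈ Pc j, ∀ ω, Y j k ω ^ 2 ≤ κ₀ * A j k ω)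
    (hmean : ∀ j, ∀ k ∈ Pc j, MeanRatio (ν j) (A j k) (g j) (cpl j ^ 2 * E₀))
    (hg : ∀ j, Integrable (g j) (ν j)) (hpg : ∀ j, Integrable (fun ω => p j ω * g j ω) (ν j))
    (hg0 : ∀ j, 0 ≤ᵐ[ν j] g j) (hp0 : ∀ j ω, 0 ≤ p j ω)
    (hplateau : ∀ j ω, (∀ i ∈ Pf j, |X j i ω| < loweredThreshold ρ₀ (cpl j) A₀ (x j) p₀) → p j ω = 1)
    (h13 : ∀ j, RegularityTransfer (Pd j) (Pc j) (Z j) (Y j)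
      (loweredThreshold ρ₀ (cpl j) A₀ (x j) p₀ / B₃) (loweredThreshold ρ₀ (cpl j) A₀ (x j) p₀ / B₃))
    (hthm1 : ∀ j, RegularityTransfer (Pf j) (Pd j) (X j) (Z j)
      (loweredThreshold ρ₀ (cpl j) A₀ (x j) p₀) (loweredThreshold ρ₀ (cpl j) A₀ (x j) p₀ / B₃)) :
    UniformSmallFieldFloor ν p g (1 / 2) := by
  -- the block threshold `b_j = a_j/B₃`, the moment `m₂,j = κ₀·cpl_j²·E₀`, the constants `B = 6N⁴`, `C = D/A₀²`
  set b : J → ℝ := fun j => loweredThreshold ρ₀ (cpl j) A₀ (x j) p₀ / B₃ with hb_def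
  set m₂ : J → ℝ := fun j => κ₀ * (cpl j ^ 2 * E₀) with hm₂_def
  have hρ' : 0 < 1 - ρ₀ := by linarith
  have hD : 0 ≤ κ₀ * E₀ * B₃ ^ 2 / ((1 - ρ₀) ^ 2 * A₀ ^ 2) :=
    div_nonneg (mul_nonneg (mul_nonneg hκ hE) (sq_nonneg _)) (mul_nonneg (sq_nonneg _) (sq_nonneg _))
  have hb : ∀ j, 0 < b j := fun j =>
    div_pos (loweredThreshold_pos hρ (hcpl j) hA₀ (by linarith [hx j])) hB₃
  -- the composite transfer and the cube condition for the BLOCK family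
  have hreg : ∀ j, RegularityTransfer (Pf j) (Pc j) (X j) (Y j)
      (loweredThreshold ρ₀ (cpl j) A₀ (x j) p₀) (b j) := fun j =>
    regularityTransfer_of_pullback_thm1 (Pf j) (Pd j) (Pc j) (X j) (Z j) (Y j) (h13 j) (hthm1 j)
  have hdom : ∀ j, ∀ᵐ ω ∂ν j,
      1 - p j ω ≤ ∑ k ∈ Pc j, (lfEvent (Y j k) (b j)).indicator (fun _ => (1 : ℝ)) ω := fun j =>
    Filter.Eventually.of_forall (defect_le_blockCount (Pf j) (Pc j) (X j) (Y j) (hp0 j) (hreg j) (hplateau j))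
  -- (Y₂) from the mean action
  have h2 : ∀ j, ∀ k ∈ Pc j, SecondMomentRatio (ν j) (Y j k) (g j) (m₂ j) := fun j k hk =>
    secondMomentRatio_of_sq_le hκ (hYA j k hk) (hY j k hk) (hg0 j) (hg j) (hmean j k hk)
  have hm : ∀ j, 0 ≤ m₂ j := fun j => mul_nonneg hκ (mul_nonneg (sq_nonneg _) hE)
  -- the count and the ratio in power-counting form
  have hcount : ∀ j, ((Pc j).card : ℝ) ≤ 6 * N ^ 4 * x j ^ (4 * r) := fun j =>
    count_le_poly (hbox j) (hn j)
  have hratio : ∀ j, m₂ j / b j ^ 2 ≤ κ₀ * E₀ * B₃ ^ 2 / ((1 - ρ₀) ^ 2 * A₀ ^ 2) / x j ^ (2 * p₀) := fun j =>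
    le_of_eq (blockRatio_eq (hcpl j).ne' hB₃.ne' (ne_of_lt hρ) hA₀.ne' (by linarith [hx j] : x j ≠ 0))
  have hBC : 2 * (6 * N ^ 4) * (κ₀ * E₀ * B₃ ^ 2 / ((1 - ρ₀) ^ 2 * A₀ ^ 2)) ≤ 1 := by
    rw [show κ₀ * E₀ * B₃ ^ 2 / ((1 - ρ₀) ^ 2 * A₀ ^ 2) = (κ₀ * E₀ * B₃ ^ 2 / (1 - ρ₀) ^ 2) / A₀ ^ 2 by
      rw [div_div]]
    exact (largeConstant_iff hA₀).2 hlarge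
  exact uniformSmallFieldFloor_half_of_largeConstant Pc Y b m₂ x (by positivity) hD (four_mul_le_two_mul hrp) hBC
    hY hb hm hg hpg hg0 hdom h2 hx hcount hratio

/-- **… WITH THE BOX GIVEN BY AN INJECTION** `Pc j ↪ BoxPlaquette 4 (n j)` (§1). [folklore] -/
theorem uniformSmallFieldFloor_half_of_boxEmbedding
    (Pf : J → Finset ι) (Pd : J → Finset δ) (Pc : J → Finset κ)
    (X : (j : J) → ι → Ω₁ j → ℝ) (Z : (j : J) → δ → Ω₁ j → ℝ) (Y A : (j : J) → κ → Ω₁ j → ℝ)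
    {κ₀ E₀ B₃ ρ₀ A₀ N : ℝ} {r p₀ : ℕ} (n : J → ℕ) (cpl x : J → ℝ)
    (φ : (j : J) → κ → BoxPlaquette 4 (n j)) (hφ : ∀ j, Set.InjOn (φ j) (Pc j))
    (hκ : 0 ≤ κ₀) (hE : 0 ≤ E₀) (hB₃ : 0 < B₃) (hρ : ρ₀ < 1) (hA₀ : 0 < A₀)
    (hrp : 2 * r ≤ p₀) (hlarge : 2 * (6 * N ^ 4) * (κ₀ * E₀ * B₃ ^ 2 / (1 - ρ₀) ^ 2) ≤ A₀ ^ 2)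
    (hcpl : ∀ j, 0 < cpl j) (hx : ∀ j, 1 ≤ x j) (hn : ∀ j, (n j : ℝ) ≤ N * x j ^ r)
    (hY : ∀ j, ∀ k ∈ Pc j, Measurable (Y j k)) (hYA : ∀ j, ∀ k ∈ Pc j, ∀ ω, Y j k ω ^ 2 ≤ κ₀ * A j k ω)
    (hmean : ∀ j, ∀ k ∈ Pc j, MeanRatio (ν j) (A j k) (g j) (cpl j ^ 2 * E₀))
    (hg : ∀ j, Integrable (g j) (ν j)) (hpg : ∀ j, Integrable (fun ω => p j ω * g j ω) (ν j))
    (hg0 : ∀ j, 0 ≤ᵐ[ν j] g j) (hp0 : ∀ j ω, 0 ≤ p j ω)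
    (hplateau : ∀ j ω, (∀ i ∈ Pf j, |X j i ω| < loweredThreshold ρ₀ (cpl j) A₀ (x j) p₀) → p j ω = 1)
    (h13 : ∀ j, RegularityTransfer (Pd j) (Pc j) (Z j) (Y j)
      (loweredThreshold ρ₀ (cpl j) A₀ (x j) p₀ / B₃) (loweredThreshold ρ₀ (cpl j) A₀ (x j) p₀ / B₃))
    (hthm1 : ∀ j, RegularityTransfer (Pf j) (Pd j) (X j) (Z j)
      (loweredThreshold ρ₀ (cpl j) A₀ (x j) p₀) (loweredThreshold ρ₀ (cpl j) A₀ (x j) p₀ / B₃)) :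
    UniformSmallFieldFloor ν p g (1 / 2) :=
  uniformSmallFieldFloor_half_of_blockCount_meanAction Pf Pd Pc X Z Y A n cpl x hκ hE hB₃ hρ hA₀ hrp hlarge
    hcpl hx (fun j => card_le_of_injOn_box_four (Pc j) (φ j) (hφ j)) hn hY hYA hmean hg hpg hg0 hp0 hplateau h13
    hthm1

/-- **… WITH THE SIDE GIVEN BY THE PRINTED RADIUS** `R_j = smallestPowGe hL (x_j^r)` and a width `w ≥ 0` in
`R_j`-units: `n j ≤ w·R_j`, `N = w·L`. [folklore] -/
theorem uniformSmallFieldFloor_half_of_printedSide {L : ℕ} (hL : 1 < L)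
    (Pf : J → Finset ι) (Pd : J → Finset δ) (Pc : J → Finset κ)
    (X : (j : J) → ι → Ω₁ j → ℝ) (Z : (j : J) → δ → Ω₁ j → ℝ) (Y A : (j : J) → κ → Ω₁ j → ℝ)
    {κ₀ E₀ B₃ ρ₀ A₀ w : ℝ} {r p₀ : ℕ} (n : J → ℕ) (cpl x : J → ℝ)
    (hκ : 0 ≤ κ₀) (hE : 0 ≤ E₀) (hB₃ : 0 < B₃) (hρ : ρ₀ < 1) (hA₀ : 0 < A₀) (hw : 0 ≤ w)
    (hrp : 2 * r ≤ p₀) (hlarge : 2 * (6 * (w * L) ^ 4) * (κ₀ * E₀ * B₃ ^ 2 / (1 - ρ₀) ^ 2) ≤ A₀ ^ 2)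
    (hcpl : ∀ j, 0 < cpl j) (hx : ∀ j, 1 ≤ x j)
    (hbox : ∀ j, (Pc j).card ≤ 6 * n j ^ 4) (hnR : ∀ j, (n j : ℝ) ≤ w * smallestPowGe hL (x j ^ r))
    (hY : ∀ j, ∀ k ∈ Pc j, Measurable (Y j k)) (hYA : ∀ j, ∀ k ∈ Pc j, ∀ ω, Y j k ω ^ 2 ≤ κ₀ * A j k ω)
    (hmean : ∀ j, ∀ k ∈ Pc j, MeanRatio (ν j) (A j k) (g j) (cpl j ^ 2 * E₀))
    (hg : ∀ j, Integrable (g j) (ν j)) (hpg : ∀ j, Integrable (fun ω => p j ω * g j ω) (ν j))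
    (hg0 : ∀ j, 0 ≤ᵐ[ν j] g j) (hp0 : ∀ j ω, 0 ≤ p j ω)
    (hplateau : ∀ j ω, (∀ i ∈ Pf j, |X j i ω| < loweredThreshold ρ₀ (cpl j) A₀ (x j) p₀) → p j ω = 1)
    (h13 : ∀ j, RegularityTransfer (Pd j) (Pc j) (Z j) (Y j)
      (loweredThreshold ρ₀ (cpl j) A₀ (x j) p₀ / B₃) (loweredThreshold ρ₀ (cpl j) A₀ (x j) p₀ / B₃))
    (hthm1 : ∀ j, RegularityTransfer (Pf j) (Pd j) (X j) (Z j)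
      (loweredThreshold ρ₀ (cpl j) A₀ (x j) p₀) (loweredThreshold ρ₀ (cpl j) A₀ (x j) p₀ / B₃)) :
    UniformSmallFieldFloor ν p g (1 / 2) :=
  uniformSmallFieldFloor_half_of_blockCount_meanAction Pf Pd Pc X Z Y A n cpl x hκ hE hB₃ hρ hA₀ hrp hlarge
    hcpl hx hbox (fun j => side_le_of_smallestPow hL hw (hx j) (hnR j)) hY hYA hmean hg hpg hg0 hp0 hplateau h13
    hthm1

end EndToEnd

/-! ## §6 SANITY: the combinatorics computes, the binders are load-bearing -/

namespace Sanity

/-- A box of side `1` in `d = 4` has exactly `6` plaquettes; of side `2`, `96`. -/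
example : Fintype.card (BoxPlaquette 4 1) = 6 ∧ Fintype.card (BoxPlaquette 4 2) = 96 := by
  rw [card_boxPlaquette_four, card_boxPlaquette_four]; norm_num

/-- In `d = 3` a unit box has `3` plaquettes, in `d = 2` one. -/
example : Fintype.card (BoxPlaquette 3 1) = 3 ∧ Fintype.card (BoxPlaquette 2 1) = 1 := by
  rw [card_boxPlaquette, card_boxPlaquette]; decide

/-- The printed radius computes: for `L = 2`, `y = 5` the smallest power of `2` above `5` is `8 ≤ 2·5`. -/
example : smallestPowGe (L := 2) (by norm_num) (5 : ℝ) = 8 := by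
  have h3 : smallestPowExp (L := 2) (by norm_num) (5 : ℝ) = 3 := by
    unfold smallestPowExp
    rw [Nat.find_eq_iff]
    refine ⟨by norm_num, fun m hm => ?_⟩
    interval_cases m <;> norm_num
  unfold smallestPowGe
  rw [h3]
  norm_num

/-- CONTROL (the bound `R ≤ L·y` needs `y ≥ 1`): for `y = 1/4`, `L = 2` the radius is `1 > 2·(1/4)`. -/
example : ¬ ((smallestPowGe (L := 2) (by norm_num) (1 / 4 : ℝ) : ℝ) ≤ 2 * (1 / 4)) := by
  have h1 : (1 : ℝ) ≤ smallestPowGe (L := 2) (by norm_num) (1 / 4 : ℝ) := by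
    exact_mod_cast one_le_smallestPowGe (L := 2) (by norm_num) (1 / 4 : ℝ)
  intro h
  linarith

/-- CONTROL (the middle threshold of a composition must match): with `Pd = Pc = Pf = {()}`, `Z = Y = X = 1`,
`Pd ← Pc` holds at `(2, 2)` and `Pf ← Pd` at `(1, 1)`, but `Pf ← Pc` FAILS at `(1, 2)`. -/
example : RegularityTransfer ({()} : Finset Unit) ({()} : Finset Unit) (fun _ (_ : Unit) => (1 : ℝ))
      (fun _ _ => (1 : ℝ)) 2 2 ∧
    RegularityTransfer ({()} : Finset Unit) ({()} : Finset Unit) (fun _ (_ : Unit) => (1 : ℝ))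
      (fun _ _ => (1 : ℝ)) 1 1 ∧
    ¬ RegularityTransfer ({()} : Finset Unit) ({()} : Finset Unit) (fun _ (_ : Unit) => (1 : ℝ))
      (fun _ _ => (1 : ℝ)) 1 2 := by
  refine ⟨regularityTransfer_self _ _ _, regularityTransfer_self _ _ _, fun h => ?_⟩
  have := h () (fun _ _ => by norm_num) () (Finset.mem_singleton_self _)
  norm_num at this

/-- CONTROL (`0 < b` is load-bearing in the pull-back shape): with no block variables and the zero datum the transfer at
threshold `0` is FALSE. -/
example : ¬ RegularityTransfer ({()} : Finset Unit) (∅ : Finset Unit) (fun _ (_ : Unit) => (0 : ℝ))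
    (fun _ _ => (0 : ℝ)) 0 0 := by
  intro h
  have := h () (fun _ hk => absurd hk (by simp)) () (Finset.mem_singleton_self _)
  norm_num at this

/-- The power counting is SHARP at `s = q`, `x = 1`, `2BC = 1` (`B = 1`, `C = 1/2`): the product is exactly `1/2` … -/
example : (1 : ℝ) * 1 ^ 1 * ((1 / 2) / 1 ^ 1) = 1 / 2 := by norm_num

/-- … and CONTROL: `s ≤ q` is load-bearing — with `s = 2 > q = 1`, `x = 2`, `B = 1`, `C = 1/2` the product is `1 > 1/2`. -/
example : ¬ ((1 : ℝ) * 2 ^ 2 * ((1 / 2) / 2 ^ 1) ≤ 1 / 2) := by norm_num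

/-- The window arithmetic on print's numbers: `p₀ = 5r` with `r = 1` gives `s = 4 ≤ q = 10`. -/
example : 4 * 1 ≤ 2 * 5 := four_mul_le_two_mul (two_mul_le_of_five_mul_le (le_refl (5 * 1)))

end Sanity

end Literature.MathematicalPhysics.QuantumFieldTheory.Balaban1983to89.T4SmallFieldFloorBlockCount
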